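import Literature.Analysis.FluidPDE.TaoCascadeCoarseModes
import Literature.Analysis.FluidPDE.TaoCascadeZeroScale
import HarnessLib

/-!
# Tao's cascade ODE, §6.7: the zero-scale estimates (6.146)–(6.151) over the hypotheses of Prop. 6.5

T. Tao, *Finite time blowup for an averaged three-dimensional Navier–Stokes equation*,
J. Amer. Math. Soc. **29** (2016), 601–674 = arXiv:1402.0290v3, §6.7, from (6.145) to (6.151).

This file instantiates the stand-alone five-mode estimates of `TaoCascadeZeroScale.lean` on the
rescaled solution of Prop. 6.5 (`RescaledHypotheses γ …`, `TaoCascadeRescaled.lean`), through the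
explicit five-mode equations of `TaoCascadeFiveModes.lean`, on a bootstrap interval `[0, T]` on
which **pointwise regime bounds** hold: `Ẽ₀ ≤ 1`, `Ẽ₁ ≤ 1`, `Ẽ₋₁ ≤ E₋` (the bounds (6.92)–(6.93)
defining `T₁`) and `|b₁| ≤ B_b`, `|c₁| ≤ B_c`, `|d₁| ≤ B_d` (Prop. 6.13, or (6.95) for `d₁`). The
outputs are the quantitative forms of

* (6.146) `a₀²+b₀²+c₀²+d₀²+a₁² = S(0) + O(t · errors)` (`zero_energy_identity`),
* (6.147) `√(b₀²+c₀²)(t) ≤ √(b₀²+c₀²)(0) + (√2ε·A² + √2η)t` (`zero_bc_growth`),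
* (6.148) Grönwall for `c₀` (`zero_c_abs_le`),
* (6.149)–(6.150) Grönwall for `√(d₀²+a₁²)` (`zero_da_sqrt_le`),
* `|a₀(t) - a₀(0)| ≤ (ε⁻² C_max D_max + η₁)t` when `|c₀| ≤ C_max`, `|d₀| ≤ D_max` (for (6.150),
  (6.156)) (`zero_a_sub_le`),
* (6.151)-type slow variation of `Ẽ₋₁` while `a₀ ≥ 0` (`neg_one_energy_le`),

with every constant explicit in `ε, K, ε₀, n₀, C₁` and the regime levels; the parameter hierarchy
("`K` large, `ε` small, `n₀` large") is *not* imposed here.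

## References

* T. Tao, J. Amer. Math. Soc. 29 (2016), 601–674, arXiv:1402.0290v3, §6.6 (6.129)–(6.133), §6.7
  (6.145)–(6.151), (6.156). [`Tao2016AveragedNS`]
-/

noncomputable section

open Set MeasureTheory intervalIntegral Filter Topology

namespace Literature.Analysis.FluidPDE

namespace TaoCascade

open Literature.Analysis.ODE

section ZeroPhase

variable {γ ε₀ K ε C₁ C₂ C₃ : ℝ} {n₀ N : ℤ} {τ : ℤ → ℝ} {Xr : Fin 4 → ℤ → ℝ → ℝ} {Er : ℤ → ℝ → ℝ}

/-- Modes of a scale whose energy is `≤ 1` are bounded by `√2`. [cite: Tao2016AveragedNS, §6.7 (6.145)] -/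
theorem RescaledHypotheses.abs_le_sqrt_two
    (h : RescaledHypotheses γ ε₀ K ε C₁ C₂ C₃ n₀ N τ Xr Er) (i : Fin 4) (k : ℤ) {t : ℝ}
    (ht : τ (n₀ - N) ≤ t) (hE : Er k t ≤ 1) : |Xr i k t| ≤ Real.sqrt 2 :=
  (h.abs_le_sqrt_energy i k ht).trans (Real.sqrt_le_sqrt (by linarith))

/-- **(6.146): almost conservation of `a₀²+b₀²+c₀²+d₀²+a₁²` on a bootstrap interval.** On `[0, T]`
with `Ẽ₀, Ẽ₁ ≤ 1`, `Ẽ₋₁ ≤ E₋` and `|b₁| ≤ B_b`, `|c₁| ≤ B_c`, `|d₁| ≤ B_d`: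
`|S(t) - S(0)| ≤ L·t`, `S = a₀²+b₀²+c₀²+d₀²+a₁²`, with
`L = 2√2(η₁ + 3η₂ + η₃) + 4√2(ε + ε²e^{-K^{10}}) + 4ν`, where
`η₁ = 2ε + 2ε²e^{-K^{10}} + 2KE₋ + C₁δ`, `η₂ = C₁δ`, `ν = (1+ε₀)^{5/2}(εB_b + ε²e^{-K^{10}}B_c)`,
`η₃ = (1+ε₀)^{5/2}ε⁻²B_cB_d + C₁(1+ε₀)^{2-n₀/2}`, `δ = (1+ε₀)^{-n₀/2}`.
[cite: Tao2016AveragedNS, §6.7 (6.146)] -/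
theorem RescaledHypotheses.zero_energy_identity
    (h : RescaledHypotheses γ ε₀ K ε C₁ C₂ C₃ n₀ N τ Xr Er) (hε : 0 < ε) (hK : 0 ≤ K) (hC₁ : 0 ≤ C₁)
    (hε₀ : 0 < ε₀) {T Em Bb Bc Bd : ℝ} (hτ0 : τ (n₀ - N) ≤ 0)
    (hreg : ∀ t ∈ Icc 0 T, Er 0 t ≤ 1 ∧ Er 1 t ≤ 1 ∧ Er (-1) t ≤ Em)
    (hsec : ∀ t ∈ Icc 0 T, |Xr 1 1 t| ≤ Bb ∧ |Xr 2 1 t| ≤ Bc ∧ |Xr 3 1 t| ≤ Bd)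
    {t : ℝ} (ht : t ∈ Icc 0 T) :
    |(Xr 0 0 t ^ 2 + Xr 1 0 t ^ 2 + Xr 2 0 t ^ 2 + Xr 3 0 t ^ 2 + Xr 0 1 t ^ 2) -
        (Xr 0 0 0 ^ 2 + Xr 1 0 0 ^ 2 + Xr 2 0 0 ^ 2 + Xr 3 0 0 ^ 2 + Xr 0 1 0 ^ 2)| ≤
      (2 * Real.sqrt 2 *
          ((2 * ε + 2 * ε ^ 2 * Real.exp (-K ^ 10) + 2 * K * Em + C₁ * (1 + ε₀) ^ (-((n₀ : ℝ) / 2))) +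
            3 * (C₁ * (1 + ε₀) ^ (-((n₀ : ℝ) / 2))) +
            ((1 + ε₀) ^ ((5 : ℝ) / 2) * (ε ^ 2)⁻¹ * Bc * Bd + C₁ * (1 + ε₀) ^ (2 - (n₀ : ℝ) / 2))) +
        2 * Real.sqrt 2 ^ 3 * (|ε| + |ε ^ 2 * Real.exp (-K ^ 10)|) +
        2 * ((1 + ε₀) ^ ((5 : ℝ) / 2) * (ε * Bb + ε ^ 2 * Real.exp (-K ^ 10) * Bc)) * Real.sqrt 2 ^ 2) *
      (t - 0) := by
  have hε₀' : -1 < ε₀ := by linarith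
  have hBb : 0 ≤ Bb := (abs_nonneg _).trans (hsec 0 ⟨le_rfl, ht.1.trans ht.2⟩).1
  have hBc : 0 ≤ Bc := (abs_nonneg _).trans (hsec 0 ⟨le_rfl, ht.1.trans ht.2⟩).2.1
  have hν : 0 ≤ (1 + ε₀) ^ ((5 : ℝ) / 2) * (ε * Bb + ε ^ 2 * Real.exp (-K ^ 10) * Bc) := by
    have : 0 ≤ (1 + ε₀) ^ ((5 : ℝ) / 2) := Real.rpow_nonneg (by linarith) _
    positivity
  refine abs_energy_sub_le (h.contDiffOn_Y 0 0) (h.contDiffOn_Y 1 0) (h.contDiffOn_Y 2 0)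
    (h.contDiffOn_Y 3 0) (h.contDiffOn_Y 0 1) hτ0 hν (t₂ := T)
    (fun s hs => h.eq_a_zero hε.le hK hC₁ hε₀' (hτ0.trans hs.1) (hreg s hs).1 (hreg s hs).2.2)
    (fun s hs => h.eq_b_zero hC₁ hε₀' (hτ0.trans hs.1) (hreg s hs).1)
    (fun s hs => h.eq_c_zero hC₁ hε₀' (hτ0.trans hs.1) (hreg s hs).1)
    (fun s hs => h.eq_d_zero hC₁ hε₀' (hτ0.trans hs.1) (hreg s hs).1)
    (fun s hs => h.eq_a_one hε hC₁ hε₀' (hτ0.trans hs.1) (hreg s hs).2.1 (hsec s hs).1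
      (hsec s hs).2.1 (hsec s hs).2.2)
    (fun s hs => h.abs_le_sqrt_two 0 0 (hτ0.trans hs.1) (hreg s hs).1)
    (fun s hs => h.abs_le_sqrt_two 1 0 (hτ0.trans hs.1) (hreg s hs).1)
    (fun s hs => h.abs_le_sqrt_two 2 0 (hτ0.trans hs.1) (hreg s hs).1)
    (fun s hs => h.abs_le_sqrt_two 3 0 (hτ0.trans hs.1) (hreg s hs).1)
    (fun s hs => h.abs_le_sqrt_two 0 1 (hτ0.trans hs.1) (hreg s hs).2.1) ht

/-- **(6.147): linear growth of `√(b₀²+c₀²)`.** On `[0, T]` with `Ẽ₀ ≤ 1` and `a₀² ≤ A²` there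
(`ε ≤ 1`): `√(b₀²+c₀²)(t) ≤ √(b₀²+c₀²)(0) + (√2 ε A² + √2 C₁(1+ε₀)^{-n₀/2}) t`.
[cite: Tao2016AveragedNS, §6.7 (6.147)] -/
theorem RescaledHypotheses.zero_bc_growth
    (h : RescaledHypotheses γ ε₀ K ε C₁ C₂ C₃ n₀ N τ Xr Er) (hε : 0 < ε) (hε1 : ε ≤ 1) (hC₁ : 0 ≤ C₁)
    (hε₀ : 0 < ε₀) {T A : ℝ} (hτ0 : τ (n₀ - N) ≤ 0)
    (hreg : ∀ t ∈ Icc 0 T, Er 0 t ≤ 1) (hA : ∀ t ∈ Icc 0 T, Xr 0 0 t ^ 2 ≤ A ^ 2)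
    {t : ℝ} (ht : t ∈ Icc 0 T) :
    Real.sqrt (Xr 1 0 t ^ 2 + Xr 2 0 t ^ 2) ≤
      Real.sqrt (Xr 1 0 0 ^ 2 + Xr 2 0 0 ^ 2) +
        (Real.sqrt 2 * ε * A ^ 2 + Real.sqrt 2 * (C₁ * (1 + ε₀) ^ (-((n₀ : ℝ) / 2)))) * (t - 0) := by
  have hε₀' : -1 < ε₀ := by linarith
  have hlam : ε ^ 2 * Real.exp (-K ^ 10) ≤ ε := by
    have h1 : Real.exp (-K ^ 10) ≤ 1 := by
      rw [Real.exp_le_one_iff]; have := pow_two_nonneg (K ^ 5); nlinarith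
    calc ε ^ 2 * Real.exp (-K ^ 10) ≤ ε ^ 2 * 1 := mul_le_mul_of_nonneg_left h1 (sq_nonneg _)
      _ = ε * ε := by ring
      _ ≤ ε * 1 := mul_le_mul_of_nonneg_left hε1 hε.le
      _ = ε := mul_one _
  exact sqrt_sq_add_sq_le (h.contDiffOn_Y 1 0) (h.contDiffOn_Y 2 0) hτ0 hε.le (by positivity) hlam
    (mul_nonneg hC₁ (Real.rpow_nonneg (by linarith) _)) hA (t₂ := T)
    (fun s hs => h.eq_b_zero hC₁ hε₀' (hτ0.trans hs.1) (hreg s hs))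
    (fun s hs => h.eq_c_zero hC₁ hε₀' (hτ0.trans hs.1) (hreg s hs)) ht

/-- **(6.148): Grönwall for `c₀`.** On `[0, T]` with `Ẽ₀ ≤ 1`:
`|c₀(t)| ≤ exp(∫₀ᵗ|ε⁻¹K^{10}b₀|)(|c₀(0)| + ∫₀ᵗ(ε²e^{-K^{10}}a₀² + C₁(1+ε₀)^{-n₀/2}))`.
[cite: Tao2016AveragedNS, §6.7 (6.148)] -/
theorem RescaledHypotheses.zero_c_abs_le
    (h : RescaledHypotheses γ ε₀ K ε C₁ C₂ C₃ n₀ N τ Xr Er) (hC₁ : 0 ≤ C₁) (hε₀ : 0 < ε₀)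
    {T : ℝ} (hτ0 : τ (n₀ - N) ≤ 0) (hreg : ∀ t ∈ Icc 0 T, Er 0 t ≤ 1) {t : ℝ} (ht : t ∈ Icc 0 T) :
    |Xr 2 0 t| ≤ Real.exp (∫ s in (0 : ℝ)..t, |ε⁻¹ * K ^ 10 * Xr 1 0 s|) *
      (|Xr 2 0 0| + ∫ s in (0 : ℝ)..t,
        (|ε ^ 2 * Real.exp (-K ^ 10)| * Xr 0 0 s ^ 2 + C₁ * (1 + ε₀) ^ (-((n₀ : ℝ) / 2)))) := by
  have hε₀' : -1 < ε₀ := by linarith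
  exact abs_c_le_exp_integral (h.contDiffOn_Y 2 0) (h.continuousOn_X 0 0 hτ0) (h.continuousOn_X 1 0 hτ0)
    hτ0 (mul_nonneg hC₁ (Real.rpow_nonneg (by linarith) _)) (t₂ := T)
    (fun s hs => h.eq_c_zero hC₁ hε₀' (hτ0.trans hs.1) (hreg s hs)) ht

/-- **(6.149)–(6.150): Grönwall for `√(d₀²+a₁²)`.** On `[0, T]` with the regime bounds:
`√(d₀²+a₁²)(t) ≤ e^{νt}(√(d₀²+a₁²)(0) + ∫₀ᵗ(ε⁻²√2|c₀| + η₂ + η₃))` with `ν, η₂, η₃` as in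
`zero_energy_identity`. [cite: Tao2016AveragedNS, §6.7 (6.149)–(6.150)] -/
theorem RescaledHypotheses.zero_da_sqrt_le
    (h : RescaledHypotheses γ ε₀ K ε C₁ C₂ C₃ n₀ N τ Xr Er) (hε : 0 < ε) (hC₁ : 0 ≤ C₁)
    (hε₀ : 0 < ε₀) {T Bb Bc Bd : ℝ} (hτ0 : τ (n₀ - N) ≤ 0)
    (hreg : ∀ t ∈ Icc 0 T, Er 0 t ≤ 1 ∧ Er 1 t ≤ 1)
    (hsec : ∀ t ∈ Icc 0 T, |Xr 1 1 t| ≤ Bb ∧ |Xr 2 1 t| ≤ Bc ∧ |Xr 3 1 t| ≤ Bd)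
    {t : ℝ} (ht : t ∈ Icc 0 T) :
    Real.sqrt (Xr 3 0 t ^ 2 + Xr 0 1 t ^ 2) ≤
      Real.exp ((1 + ε₀) ^ ((5 : ℝ) / 2) * (ε * Bb + ε ^ 2 * Real.exp (-K ^ 10) * Bc) * (t - 0)) *
        (Real.sqrt (Xr 3 0 0 ^ 2 + Xr 0 1 0 ^ 2) + ∫ s in (0 : ℝ)..t,
          ((ε ^ 2)⁻¹ * Real.sqrt 2 * |Xr 2 0 s| + C₁ * (1 + ε₀) ^ (-((n₀ : ℝ) / 2)) +
            ((1 + ε₀) ^ ((5 : ℝ) / 2) * (ε ^ 2)⁻¹ * Bc * Bd + C₁ * (1 + ε₀) ^ (2 - (n₀ : ℝ) / 2)))) := by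
  have hε₀' : -1 < ε₀ := by linarith
  have hq : 0 ≤ (1 + ε₀) ^ ((5 : ℝ) / 2) := Real.rpow_nonneg (by linarith) _
  have hBb : 0 ≤ Bb := (abs_nonneg _).trans (hsec 0 ⟨le_rfl, ht.1.trans ht.2⟩).1
  have hBc : 0 ≤ Bc := (abs_nonneg _).trans (hsec 0 ⟨le_rfl, ht.1.trans ht.2⟩).2.1
  have hBd : 0 ≤ Bd := (abs_nonneg _).trans (hsec 0 ⟨le_rfl, ht.1.trans ht.2⟩).2.2
  have hη₃ : 0 ≤ (1 + ε₀) ^ ((5 : ℝ) / 2) * (ε ^ 2)⁻¹ * Bc * Bd + C₁ * (1 + ε₀) ^ (2 - (n₀ : ℝ) / 2) := by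
    have : 0 ≤ C₁ * (1 + ε₀) ^ (2 - (n₀ : ℝ) / 2) := mul_nonneg hC₁ (Real.rpow_nonneg (by linarith) _)
    positivity
  exact sqrt_d_sq_add_a_sq_le (h.contDiffOn_Y 3 0) (h.contDiffOn_Y 0 1) (h.continuousOn_X 2 0 hτ0)
    hτ0 (by positivity) (by positivity) (mul_nonneg hC₁ (Real.rpow_nonneg (by linarith) _)) hη₃
    (t₂ := T) (fun s hs => h.abs_le_sqrt_two 0 0 (hτ0.trans hs.1) (hreg s hs).1)
    (fun s hs => h.eq_d_zero hC₁ hε₀' (hτ0.trans hs.1) (hreg s hs).1)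
    (fun s hs => h.eq_a_one hε hC₁ hε₀' (hτ0.trans hs.1) (hreg s hs).2 (hsec s hs).1
      (hsec s hs).2.1 (hsec s hs).2.2) ht

/-- **`a₀` barely moves while `c₀, d₀` are small** ((6.150): "`|∂ₜa₀| ≲ …`, which among other
things implies that `a₀(t) ≥ 0`"; (6.156): "`∂ₜa₀ = O(K⁻⁹)` … `a₀(t) = 1 + O(K⁻⁹)`"): on `[0, T]`
with `Ẽ₀ ≤ 1`, `Ẽ₋₁ ≤ E₋`, `|c₀| ≤ C_max`, `|d₀| ≤ D_max`:
`|a₀(t) - a₀(0)| ≤ (ε⁻² C_max D_max + 2ε + 2ε²e^{-K^{10}} + 2KE₋ + C₁(1+ε₀)^{-n₀/2}) t`.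
[cite: Tao2016AveragedNS, §6.7 (6.150), (6.156)] -/
theorem RescaledHypotheses.zero_a_sub_le
    (h : RescaledHypotheses γ ε₀ K ε C₁ C₂ C₃ n₀ N τ Xr Er) (hε : 0 < ε) (hK : 0 ≤ K) (hC₁ : 0 ≤ C₁)
    (hε₀ : 0 < ε₀) {T Em Cmax Dmax : ℝ} (hτ0 : τ (n₀ - N) ≤ 0)
    (hreg : ∀ t ∈ Icc 0 T, Er 0 t ≤ 1 ∧ Er (-1) t ≤ Em)
    (hcd : ∀ t ∈ Icc 0 T, |Xr 2 0 t| ≤ Cmax ∧ |Xr 3 0 t| ≤ Dmax) {t : ℝ} (ht : t ∈ Icc 0 T) :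
    |Xr 0 0 t - Xr 0 0 0| ≤
      ((ε ^ 2)⁻¹ * Cmax * Dmax +
        (2 * ε + 2 * ε ^ 2 * Real.exp (-K ^ 10) + 2 * K * Em + C₁ * (1 + ε₀) ^ (-((n₀ : ℝ) / 2)))) *
        (t - 0) := by
  have hε₀' : -1 < ε₀ := by linarith
  have hCmax : 0 ≤ Cmax := (abs_nonneg _).trans (hcd 0 ⟨le_rfl, ht.1.trans ht.2⟩).1
  have key := norm_image_sub_le_of_norm_deriv_right_le_segment (h.continuousOn_X 0 0 hτ0 (b := T))
    (fun s hs => h.hasDeriv_X 0 0 (hτ0.trans hs.1))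
    (C := (ε ^ 2)⁻¹ * Cmax * Dmax +
      (2 * ε + 2 * ε ^ 2 * Real.exp (-K ^ 10) + 2 * K * Em + C₁ * (1 + ε₀) ^ (-((n₀ : ℝ) / 2))))
    ?_ t ht
  · simpa [Real.norm_eq_abs] using key
  · intro s hs
    have hs' : s ∈ Icc 0 T := Ico_subset_Icc_self hs
    have he := h.eq_a_zero hε.le hK hC₁ hε₀' (hτ0.trans hs.1) (hreg s hs').1 (hreg s hs').2
    have hprod : |(ε ^ 2)⁻¹ * Xr 2 0 s * Xr 3 0 s| ≤ (ε ^ 2)⁻¹ * Cmax * Dmax := by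
      rw [abs_mul, abs_mul, abs_of_pos (by positivity : (0 : ℝ) < (ε ^ 2)⁻¹)]
      have := mul_le_mul (hcd s hs').1 (hcd s hs').2 (abs_nonneg _) hCmax
      calc (ε ^ 2)⁻¹ * |Xr 2 0 s| * |Xr 3 0 s| = (ε ^ 2)⁻¹ * (|Xr 2 0 s| * |Xr 3 0 s|) := by ring
        _ ≤ (ε ^ 2)⁻¹ * (Cmax * Dmax) := mul_le_mul_of_nonneg_left this (by positivity)
        _ = _ := by ring
    rw [Real.norm_eq_abs]
    have := abs_sub (derivWithin (Xr 0 0) (Ici (τ (n₀ - N))) s +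
      (ε ^ 2)⁻¹ * Xr 2 0 s * Xr 3 0 s) ((ε ^ 2)⁻¹ * Xr 2 0 s * Xr 3 0 s)
    simp only [add_sub_cancel_right] at this
    linarith

/-- **(6.151): `Ẽ₋₁` varies slowly while `a₀ ≥ 0`.** On `[0, T]` with `Ẽ₋₁ ≤ E₁`, `Ẽ₋₂ ≤ E₂`
and `a₀ ≥ 0` there: `Ẽ₋₁(t) ≤ Ẽ₋₁(0) + 2K(1+ε₀)^{-5/2}E₂√(2E₁)·t` ("`∂ₜẼ₋₁ ≤ O(K^{-14})` on this
interval"). [cite: Tao2016AveragedNS, §6.7 (6.151)] -/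
theorem RescaledHypotheses.neg_one_energy_le
    (h : RescaledHypotheses γ ε₀ K ε C₁ C₂ C₃ n₀ N τ Xr Er) (hK : 0 ≤ K) (hε₀ : 0 < ε₀)
    {T E₁ E₂ : ℝ} (hτ0 : τ (n₀ - N) ≤ 0)
    (hreg : ∀ t ∈ Icc 0 T, Er (-1) t ≤ E₁ ∧ Er (-2) t ≤ E₂) (ha : ∀ t ∈ Icc 0 T, 0 ≤ Xr 0 0 t)
    {t : ℝ} (ht : t ∈ Icc 0 T) :
    Er (-1) t ≤ Er (-1) 0 + 2 * K * (1 + ε₀) ^ (-((5 : ℝ) / 2)) * E₂ * Real.sqrt (2 * E₁) * (t - 0) := by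
  have hε₀' : -1 < ε₀ := by linarith
  have hb := le_add_integral_of_deriv_right_le (h.continuousOn_E (-1) hτ0)
    (fun s hs => h.hasDeriv_E (-1) (hτ0.trans hs.1))
    (A := fun _ => 2 * K * (1 + ε₀) ^ (-((5 : ℝ) / 2)) * E₂ * Real.sqrt (2 * E₁))
    continuousOn_const ?_ ht (b := T)
  · have hI : ∫ s in (0 : ℝ)..t,
        (fun _ : ℝ => 2 * K * (1 + ε₀) ^ (-((5 : ℝ) / 2)) * E₂ * Real.sqrt (2 * E₁)) s =
        2 * K * (1 + ε₀) ^ (-((5 : ℝ) / 2)) * E₂ * Real.sqrt (2 * E₁) * (t - 0) := by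
      simp only [intervalIntegral.integral_const, smul_eq_mul]; ring
    rw [hI] at hb; exact hb
  · intro s hs
    have hs' : s ∈ Icc 0 T := Ico_subset_Icc_self hs
    have he := h.energy_neg_one_deriv_le hK hε₀' (hτ0.trans hs.1) (hreg s hs').1 (hreg s hs').2
    have hdrain : 0 ≤ K * Xr 3 (-1) s ^ 2 * Xr 0 0 s := by
      have := ha s hs'; positivity
    show derivWithin (Er (-1)) (Ici (τ (n₀ - N))) s ≤ _
    linarith

/-- **The forward-flow quantity `∫₀ᵗ a₁²` is small while `|a₁| ≤ A₁`**: `∫₀ᵗ a₁² ≤ A₁² t`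
(for (6.151)/(6.160): "`∫₀^{t_c} a₁² ≲ K^{-10}`"). [cite: Tao2016AveragedNS, §6.7 (6.160)] -/
theorem RescaledHypotheses.integral_a_one_sq_le
    (h : RescaledHypotheses γ ε₀ K ε C₁ C₂ C₃ n₀ N τ Xr Er) {T A₁ : ℝ} (hτ0 : τ (n₀ - N) ≤ 0)
    (ha : ∀ t ∈ Icc 0 T, |Xr 0 1 t| ≤ A₁) {t : ℝ} (ht : t ∈ Icc 0 T) :
    ∫ s in (0 : ℝ)..t, Xr 0 1 s ^ 2 ≤ A₁ ^ 2 * t := by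
  have hc : ContinuousOn (fun s => Xr 0 1 s ^ 2) (Icc 0 t) := (h.continuousOn_X 0 1 hτ0).pow 2
  have h1 : ∫ s in (0 : ℝ)..t, Xr 0 1 s ^ 2 ≤ ∫ s in (0 : ℝ)..t, A₁ ^ 2 := by
    apply integral_mono_on ht.1 (hc.intervalIntegrable_of_Icc ht.1) (continuous_const.intervalIntegrable _ _)
    intro s hs
    have := ha s ⟨hs.1, hs.2.trans ht.2⟩
    rw [← sq_abs]
    exact pow_le_pow_left₀ (abs_nonneg _) this 2
  have h2 : ∫ s in (0 : ℝ)..t, A₁ ^ 2 = A₁ ^ 2 * t := by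
    simp only [intervalIntegral.integral_const, smul_eq_mul]; ring
  linarith

end ZeroPhase

end TaoCascade

end Literature.Analysis.FluidPDE
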